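import Summits.AtomisticToContinuum.Crystallization.Theorems.OverbindingBudgetAffineRunCutChiralityLink
import Summits.AtomisticToContinuum.Crystallization.Theorems.OverbindingBudgetAffineRunCutWordCount

/-!
# `OverbindingBudget` / crux `RobustDefectLimitWindows` (stmt-AtomisticToContinuum-31280) — «RunCut» SW♭: the chirality line IN THE CHART FRAME, per column

Support file (lens-4 g87, hand-in 3 item 2 «C-XASM», analytic half at FRAME LEVEL; memo `HOME/decomp-a2c-lens-4/g87/memo/SW-CHI.md` §8).
`…ChiralityLink.bilayer_exchange_le_milli/_window` bound the class-exchange sum of ONE exchanged bilayer for an abstract layer-frame defect `C` with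
`Σ C_ij² ≤ 3/2·θ₀²`; `…ChiralityCap` derived exactly that Frobenius bound for `C = Fᵀ B F` from the `AffFramed` chart constraint on the six second-shell
pattern vectors (`‖B v‖ ≤ θ₀`; `B` = pattern-frame defect `Q⁻¹A − 1`, `F` = orthogonal change to the layer frame); `…WordCount.abs_sum_exchanged_le` counts
the exchanged bilayers of a TRIPLE column (exactly three).  This file composes the three — no new estimate:

* `bilayerExchange a C` (definition) — the exchanged-bilayer class-exchange sum `Σ'_{ij} [ljSq(P + t_r) − ljSq(P + t_r̄)]` of `…ChiralityLink` as one symbol;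
* `sum_sq_layerFrame_le_fcc/hcp` — `Σ (FᵀBF)_ij² ≤ 3/2·θ²` from the six second-shell constraints (fcc / hcp pattern);
* ★ `bilayerExchange_frame_le_milli_fcc/hcp`, `bilayerExchange_frame_le_window_fcc/hcp` — the bilayer bound with `C := Fᵀ B F` read off the chart data;
* ★ `column_chirality_le` — per TRIPLE column, each exchanged bilayer read in ITS OWN chart (scale `a i ≥ a₀ > 0`, frame defect `C i` with the Frobenius
  bound), `|Σ_{i∈I} 𝟙[step i reversed]·bilayerExchange (a i) (C i)| ≤ 3·(¾·10⁻⁶·K + 544·10⁻⁹·a₀⁻¹² + 246·10⁻⁹·a₀⁻⁶)` under `|κ(a i)| ≤ K`;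
  ★ `column_chirality_le_window` — on the movers' window `a i ≥ 106/125`: `≤ 3·(3/10⁵ + 46/10⁷)`;
* §5 ★ FROM THE CHART DATA of `AffFramed` (`Q : E3 →ₗᵢ[ℝ] E3`, `A : E3 →ₗ[ℝ] E3`, `∀ v ∈ P, ‖A v − Q v‖ ≤ θ`, `P` = fcc / hcp two-shell pattern):
  `defectMatrix Q A` = the matrix of `Q⁻¹A − 1` in the standard frame, `sum_sq_defect` (`Σ_i (Σ_j B_ij v_j)² = ‖A v − Q v‖²`), the six second-shell
  constraints `defect_secondShell_fcc/hcp`, ★ `sum_sq_layerFrame_chart_le` (`Σ (Fᵀ·defectMatrix Q A·F)² ≤ 3/2·θ²` for either pattern) and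
  ★ `bilayerExchange_chart_le_milli/_window` — the bilayer bound with NO matrix hypothesis left, only the `AffFramed` clauses `hP`, `hθ` and a layer frame `F`;
* `margin_arith_binding_end` — the ARITHMETIC of the budget of record at the binding end `a = 106/125` (memo SW-G1 §9.4 / SW-CHI §0.3): with the chirality
  line as certified here (`κ ≤ 40`, remainder profile at `u = (125/106)⁶`) and the other lines entered as the LITERAL allowances of record (`85/10⁶` =
  roughness + forces×η + chart drift + forgone + coarse; `61/10¹⁰` cross-patch — three of these are not yet theorems), `1.3 × total ≤ (1 − 0.123)·G_T(106/125)`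
  where `G_T` is the profile polynomial of `…AxialWindowProfile.triple_column_gain_profile` — i.e. the 12.3 % margin, as `norm_num` arithmetic.
[this file: 3 definitions (`bilayerExchange`, `chartDefect`, `defectMatrix`) + 1 `abbrev` (`chartInv`), 19 theorems; standard axioms]
-/

noncomputable section

namespace Summit.AtomisticToContinuum.Crystallization.Theorems.OverbindingBudgetAffineRunCutChiralityFrame

open Finset Matrix
open Literature.MathematicalPhysics.StatisticalMechanics
open Literature.MathematicalPhysics.StatisticalMechanics.StackingSums
open Summit.AtomisticToContinuum.Crystallization.Theorems.ChargedEnergyGapNegative (E3)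
open Literature.Geometry.DiscreteGeometry (intVec intVec_apply scaledPattern fccSecondShellInt hcpSecondShellInt fccTwoShellPattern hcpTwoShellPattern)
open Summit.AtomisticToContinuum.Crystallization.Theorems.OverbindingBudgetAffineRunCutForgone (ljSq)
open Summit.AtomisticToContinuum.Crystallization.Theorems.OverbindingBudgetAffineRunCutChiral (kappaLJ)
open Summit.AtomisticToContinuum.Crystallization.Theorems.OverbindingBudgetAffineRunCutChiralKernel (abs_kappaLJ_le_forty)
open Summit.AtomisticToContinuum.Crystallization.Theorems.OverbindingBudgetAffineRunCutChiralityCap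
open Summit.AtomisticToContinuum.Crystallization.Theorems.OverbindingBudgetAffineRunCutChiralityDeform (strainT classBar)
open Summit.AtomisticToContinuum.Crystallization.Theorems.OverbindingBudgetAffineRunCutChiralityLink
open Summit.AtomisticToContinuum.Crystallization.Theorems.OverbindingBudgetAffineRunCutWord (tripleFlip)
open Summit.AtomisticToContinuum.Crystallization.Theorems.OverbindingBudgetAffineRunCutWordCount (abs_sum_exchanged_le)

/-! ## §1. The exchanged-bilayer sum as one symbol; the Frobenius bound in the layer frame -/

/-- **The class-exchange sum of one exchanged bilayer** at own scale `a` with layer-frame chart defect `C` (the quantity bounded by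
`…ChiralityLink.bilayer_exchange_le`). [this file · kind: definition] -/
def bilayerExchange (a : ℝ) (C : Matrix (Fin 3) (Fin 3) ℝ) : ℝ :=
  ∑' ij : ℤ × ℤ, (ljSq (a ^ 2 * (stackForm 1 ij.1 ij.2 + 2 / 3) + strainT C (bond a ij))
    - ljSq (a ^ 2 * (stackForm 1 ij.1 ij.2 + 2 / 3) + strainT C (classBar (bond a ij))))

/-- **Frobenius bound of the layer-frame defect, fcc chart**: `Σ (FᵀBF)_ij² ≤ 3/2·θ²` from the six fcc second-shell constraints. [this file · kind: proof] -/
theorem sum_sq_layerFrame_le_fcc (B F : Matrix (Fin 3) (Fin 3) ℝ) (hF : Fᵀ * F = 1) {θ : ℝ}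
    (hB : ∀ w ∈ fccSecondShellInt, ∑ i, (∑ j, B i j * ((Real.sqrt (2 : ℕ))⁻¹ * (w j : ℝ))) ^ 2 ≤ θ ^ 2) :
    ∑ i, ∑ j, (Fᵀ * B * F) i j ^ 2 ≤ 3 / 2 * θ ^ 2 := by
  rw [sum_sq_frame B F hF]
  exact sum_sq_le_of_shell fccSecondShellInt (fun w j => (Real.sqrt (2 : ℕ))⁻¹ * (w j : ℝ)) B
    (moment_of_int fccSecondShellInt (by norm_num) fccSecondShellInt_moment) card_secondShellInt.1 hB

/-- **Frobenius bound of the layer-frame defect, hcp chart.** [this file · kind: proof] -/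
theorem sum_sq_layerFrame_le_hcp (B F : Matrix (Fin 3) (Fin 3) ℝ) (hF : Fᵀ * F = 1) {θ : ℝ}
    (hB : ∀ w ∈ hcpSecondShellInt, ∑ i, (∑ j, B i j * ((Real.sqrt (18 : ℕ))⁻¹ * (w j : ℝ))) ^ 2 ≤ θ ^ 2) :
    ∑ i, ∑ j, (Fᵀ * B * F) i j ^ 2 ≤ 3 / 2 * θ ^ 2 := by
  rw [sum_sq_frame B F hF]
  exact sum_sq_le_of_shell hcpSecondShellInt (fun w j => (Real.sqrt (18 : ℕ))⁻¹ * (w j : ℝ)) B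
    (moment_of_int hcpSecondShellInt (by norm_num) hcpSecondShellInt_moment) card_secondShellInt.2 hB

/-! ## §2. ★ The bilayer bound read off the chart data -/

/-- ★ **fcc chart, profile form**: `|bilayerExchange a (FᵀBF)| ≤ ¾·10⁻⁶·|κ(a)| + 544·10⁻⁹·a⁻¹² + 246·10⁻⁹·a⁻⁶` at `θ₀ = 10⁻³`. [this file · kind: proof] -/
theorem bilayerExchange_frame_le_milli_fcc {a : ℝ} (ha : 0 < a) (B F : Matrix (Fin 3) (Fin 3) ℝ) (hF : Fᵀ * F = 1)
    (hB : ∀ w ∈ fccSecondShellInt, ∑ i, (∑ j, B i j * ((Real.sqrt (2 : ℕ))⁻¹ * (w j : ℝ))) ^ 2 ≤ (1 / 1000 : ℝ) ^ 2) :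
    |bilayerExchange a (Fᵀ * B * F)| ≤ 3 / 4 * (1 / 1000) ^ 2 * |kappaLJ a| + 544 / 10 ^ 9 * (a⁻¹) ^ 12 + 246 / 10 ^ 9 * (a⁻¹) ^ 6 :=
  (bilayer_exchange_le_milli ha (Fᵀ * B * F) (sum_sq_layerFrame_le_fcc B F hF hB)).2

/-- ★ **hcp chart, profile form.** [this file · kind: proof] -/
theorem bilayerExchange_frame_le_milli_hcp {a : ℝ} (ha : 0 < a) (B F : Matrix (Fin 3) (Fin 3) ℝ) (hF : Fᵀ * F = 1)
    (hB : ∀ w ∈ hcpSecondShellInt, ∑ i, (∑ j, B i j * ((Real.sqrt (18 : ℕ))⁻¹ * (w j : ℝ))) ^ 2 ≤ (1 / 1000 : ℝ) ^ 2) :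
    |bilayerExchange a (Fᵀ * B * F)| ≤ 3 / 4 * (1 / 1000) ^ 2 * |kappaLJ a| + 544 / 10 ^ 9 * (a⁻¹) ^ 12 + 246 / 10 ^ 9 * (a⁻¹) ^ 6 :=
  (bilayer_exchange_le_milli ha (Fᵀ * B * F) (sum_sq_layerFrame_le_hcp B F hF hB)).2

/-- ★ **fcc chart, movers' window** `a ≥ 106/125`: `|bilayerExchange a (FᵀBF)| ≤ 3/10⁵ + 46/10⁷`. [this file · kind: proof] -/
theorem bilayerExchange_frame_le_window_fcc {a : ℝ} (ha : 106 / 125 ≤ a) (B F : Matrix (Fin 3) (Fin 3) ℝ) (hF : Fᵀ * F = 1)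
    (hB : ∀ w ∈ fccSecondShellInt, ∑ i, (∑ j, B i j * ((Real.sqrt (2 : ℕ))⁻¹ * (w j : ℝ))) ^ 2 ≤ (1 / 1000 : ℝ) ^ 2) :
    |bilayerExchange a (Fᵀ * B * F)| ≤ 3 / 100000 + 46 / 10 ^ 7 :=
  bilayer_exchange_le_window ha (Fᵀ * B * F) (sum_sq_layerFrame_le_fcc B F hF hB)

/-- ★ **hcp chart, movers' window.** [this file · kind: proof] -/
theorem bilayerExchange_frame_le_window_hcp {a : ℝ} (ha : 106 / 125 ≤ a) (B F : Matrix (Fin 3) (Fin 3) ℝ) (hF : Fᵀ * F = 1)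
    (hB : ∀ w ∈ hcpSecondShellInt, ∑ i, (∑ j, B i j * ((Real.sqrt (18 : ℕ))⁻¹ * (w j : ℝ))) ^ 2 ≤ (1 / 1000 : ℝ) ^ 2) :
    |bilayerExchange a (Fᵀ * B * F)| ≤ 3 / 100000 + 46 / 10 ^ 7 :=
  bilayer_exchange_le_window ha (Fᵀ * B * F) (sum_sq_layerFrame_le_hcp B F hF hB)

/-! ## §3. ★ Per TRIPLE column: exactly three exchanged bilayers, each in its own chart -/

/-- ★ **THE CHIRALITY LINE PER TRIPLE COLUMN, profile form**: bilayer `i` (between layers `i−1`, `i`) is exchanged iff step `i` is reversed by the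
TRIPLE flip at `j`; each exchanged bilayer is read in its own chart (scale `a i ≥ a₀ > 0`, layer-frame defect `C i` with `Σ (C i)² ≤ 3/2·10⁻⁶`) and
`|κ(a i)| ≤ K`; then the column's chirality line is at most `3·(¾·10⁻⁶·K + 544·10⁻⁹·a₀⁻¹² + 246·10⁻⁹·a₀⁻⁶)`. [this file · kind: proof] -/
theorem column_chirality_le {s : ℤ → ℤ} (hs : IsHaggSeq s) (j : ℤ) (I : Finset ℤ) (a : ℤ → ℝ) (C : ℤ → Matrix (Fin 3) (Fin 3) ℝ)
    {a₀ K : ℝ} (ha0 : 0 < a₀) (hK : 0 ≤ K) (ha : ∀ i ∈ I, a₀ ≤ a i) (hκ : ∀ i ∈ I, |kappaLJ (a i)| ≤ K)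
    (hC : ∀ i ∈ I, ∑ k, ∑ l, C i k l ^ 2 ≤ 3 / 2 * (1 / 1000) ^ 2) :
    |∑ i ∈ I, (if tripleFlip j s i ≠ s i then bilayerExchange (a i) (C i) else 0)|
      ≤ 3 * (3 / 4 * (1 / 1000) ^ 2 * K + 544 / 10 ^ 9 * (a₀⁻¹) ^ 12 + 246 / 10 ^ 9 * (a₀⁻¹) ^ 6) := by
  refine abs_sum_exchanged_le hs j I (fun i => bilayerExchange (a i) (C i)) (by positivity) fun i hi => ?_
  have hai : 0 < a i := ha0.trans_le (ha i hi)
  have hle := (bilayer_exchange_le_milli hai (C i) (hC i hi)).2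
  have hinv : (a i)⁻¹ ≤ a₀⁻¹ := (inv_le_inv₀ hai ha0).2 (ha i hi)
  have hinv0 : 0 ≤ (a i)⁻¹ := by positivity
  have h12 : ((a i)⁻¹) ^ 12 ≤ (a₀⁻¹) ^ 12 := pow_le_pow_left₀ hinv0 hinv 12
  have h6 : ((a i)⁻¹) ^ 6 ≤ (a₀⁻¹) ^ 6 := pow_le_pow_left₀ hinv0 hinv 6
  have hk := hκ i hi
  change |bilayerExchange (a i) (C i)| ≤ _
  unfold bilayerExchange
  nlinarith [hle, h12, h6, hk, abs_nonneg (kappaLJ (a i))]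

/-- ★ **THE CHIRALITY LINE PER TRIPLE COLUMN on the movers' window** `a i ≥ 106/125`: `≤ 3·(3/10⁵ + 46/10⁷)` (= `1.038·10⁻⁴`; memo SW-CHI §0.3).
[this file · kind: proof] -/
theorem column_chirality_le_window {s : ℤ → ℤ} (hs : IsHaggSeq s) (j : ℤ) (I : Finset ℤ) (a : ℤ → ℝ) (C : ℤ → Matrix (Fin 3) (Fin 3) ℝ)
    (ha : ∀ i ∈ I, 106 / 125 ≤ a i) (hC : ∀ i ∈ I, ∑ k, ∑ l, C i k l ^ 2 ≤ 3 / 2 * (1 / 1000) ^ 2) :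
    |∑ i ∈ I, (if tripleFlip j s i ≠ s i then bilayerExchange (a i) (C i) else 0)| ≤ 3 * (3 / 100000 + 46 / 10 ^ 7) :=
  abs_sum_exchanged_le hs j I (fun i => bilayerExchange (a i) (C i)) (by norm_num) fun i hi =>
    bilayer_exchange_le_window (ha i hi) (C i) (hC i hi)

/-! ## §4. The arithmetic of the margin of record at the binding end -/

/-- **MARGIN ARITHMETIC AT THE BINDING END `a = 106/125`** (memo SW-G1 §9.4 re-charged, SW-CHI §0.3).  Chirality per column as certified above
(`κ ≤ 40`, remainder profile at `u = (125/106)⁶`); the other lines as the LITERAL allowances of record (`85/10⁶`: roughness + forces×η + chart drift +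
forgone + coarse — the first three are NOT yet theorems; `61/10¹⁰`: cross-patch); `G_T(106/125)` = the profile polynomial of `triple_column_gain_profile`
evaluated (`≈ 2.79968·10⁻⁴`).  Then `1.3 × total ≤ (1 − 123/1000)·G_T`, i.e. the margin of record is ≥ 12.3 %.  Pure arithmetic; it certifies the
bookkeeping, not the allowances. [this file · kind: proof (computational arithmetic, `norm_num`)] -/
theorem margin_arith_binding_end :
    13 / 10 * (3 * (3 / 4 * (1 / 1000 : ℝ) ^ 2 * 40 + 544 / 10 ^ 9 * (((106 / 125 : ℝ)⁻¹) ^ 6) ^ 2 + 246 / 10 ^ 9 * ((106 / 125 : ℝ)⁻¹) ^ 6)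
        + 85 / 10 ^ 6 + 61 / 10 ^ 10)
      ≤ (1 - 123 / 1000) *
        -(4 * (1 / 12 * (((106 / 125 : ℝ)⁻¹) ^ 6) ^ 2 * 0.0002161 - 1 / 6 * ((106 / 125 : ℝ)⁻¹) ^ 6 * 0.0004712)
          + 6 * ((1 / 12 * (((106 / 125 : ℝ)⁻¹) ^ 6) ^ 2 * 0.000004790304961 + 1 / 6 * ((106 / 125 : ℝ)⁻¹) ^ 6 * 0.0000037012) +
              (1 / 12 * (((106 / 125 : ℝ)⁻¹) ^ 6) ^ 2 * (1 / 5000) + 1 / 6 * ((106 / 125 : ℝ)⁻¹) ^ 6 * 126) * (1 / 5 * ((21 : ℝ)⁻¹) ^ 5))) := by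
  norm_num

/-! ## §5. ★ From the chart data of `AffFramed`: the defect matrix and its second-shell constraints -/

/-- The inverse of the chart isometry (finite dimension: a linear isometry `E3 → E3` is onto). [this file · kind: definition (abbreviation)] -/
abbrev chartInv (Q : E3 →ₗᵢ[ℝ] E3) : E3 ≃ₗᵢ[ℝ] E3 := Q.toLinearIsometryEquiv rfl

/-- **The chart defect map** `Q⁻¹ ∘ A − id` of the `AffFramed` data `(Q, A)`. [this file · kind: definition] -/
def chartDefect (Q : E3 →ₗᵢ[ℝ] E3) (A : E3 →ₗ[ℝ] E3) : E3 →ₗ[ℝ] E3 :=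
  ((chartInv Q).symm.toLinearEquiv : E3 ≃ₗ[ℝ] E3).toLinearMap.comp A - LinearMap.id

/-- **The defect matrix** `B = Q⁻¹A − 1` in the standard (pattern) frame. [this file · kind: definition] -/
def defectMatrix (Q : E3 →ₗᵢ[ℝ] E3) (A : E3 →ₗ[ℝ] E3) : Matrix (Fin 3) (Fin 3) ℝ :=
  LinearMap.toMatrix (EuclideanSpace.basisFun (Fin 3) ℝ).toBasis (EuclideanSpace.basisFun (Fin 3) ℝ).toBasis (chartDefect Q A)

/-- `chartDefect_apply` (docstring added by the landing lane; see the module docstring). [formal bookkeeping] -/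
theorem chartDefect_apply (Q : E3 →ₗᵢ[ℝ] E3) (A : E3 →ₗ[ℝ] E3) (v : E3) :
    chartDefect Q A v = (chartInv Q).symm (A v) - v := rfl

/-- `‖(Q⁻¹A − 1) v‖ = ‖A v − Q v‖`. [this file · kind: proof] -/
theorem norm_chartDefect (Q : E3 →ₗᵢ[ℝ] E3) (A : E3 →ₗ[ℝ] E3) (v : E3) : ‖chartDefect Q A v‖ = ‖A v - Q v‖ := by
  have hQ : (chartInv Q).symm (Q v) = v := by
    have h := (chartInv Q).symm_apply_apply v
    rwa [LinearIsometry.toLinearIsometryEquiv_apply] at h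
  have h : (chartInv Q).symm (A v) - v = (chartInv Q).symm (A v - Q v) := by rw [map_sub, hQ]
  rw [chartDefect_apply, h, LinearIsometryEquiv.norm_map]

/-- The defect matrix acts by the defect map: `Σ_j B_ij v_j = ((Q⁻¹A − 1) v)_i`. [this file · kind: proof] -/
theorem defectMatrix_mulVec (Q : E3 →ₗᵢ[ℝ] E3) (A : E3 →ₗ[ℝ] E3) (v : E3) (i : Fin 3) :
    ∑ j, defectMatrix Q A i j * v j = chartDefect Q A v i := by
  have h := congrFun (LinearMap.toMatrix_mulVec_repr (EuclideanSpace.basisFun (Fin 3) ℝ).toBasis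
    (EuclideanSpace.basisFun (Fin 3) ℝ).toBasis (chartDefect Q A) v) i
  simp only [Matrix.mulVec, dotProduct, OrthonormalBasis.coe_toBasis_repr_apply, EuclideanSpace.basisFun_repr] at h
  exact h

/-- `Σ_i (Σ_j B_ij v_j)² = ‖A v − Q v‖²`. [this file · kind: proof] -/
theorem sum_sq_defect (Q : E3 →ₗᵢ[ℝ] E3) (A : E3 →ₗ[ℝ] E3) (v : E3) :
    ∑ i, (∑ j, defectMatrix Q A i j * v j) ^ 2 = ‖A v - Q v‖ ^ 2 := by
  simp_rw [defectMatrix_mulVec]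
  rw [← norm_chartDefect, EuclideanSpace.real_norm_sq_eq]

/-- **The six fcc second-shell constraints** on the defect matrix, from the `AffFramed` clause `∀ v ∈ fccTwoShellPattern, ‖A v − Q v‖ ≤ θ`.
[this file · kind: proof] -/
theorem defect_secondShell_fcc {Q : E3 →ₗᵢ[ℝ] E3} {A : E3 →ₗ[ℝ] E3} {θ : ℝ} (hθ : ∀ v ∈ fccTwoShellPattern, ‖A v - Q v‖ ≤ θ) :
    ∀ w ∈ fccSecondShellInt, ∑ i, (∑ j, defectMatrix Q A i j * ((Real.sqrt (2 : ℕ))⁻¹ * (w j : ℝ))) ^ 2 ≤ θ ^ 2 := by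
  intro w hw
  have hv : ((Real.sqrt (2 : ℕ))⁻¹ • intVec w : E3) ∈ fccTwoShellPattern := by
    simp only [fccTwoShellPattern, scaledPattern, Finset.mem_image]
    exact ⟨w, Finset.mem_union_right _ hw, rfl⟩
  have hc : ∀ j, (Real.sqrt (2 : ℕ))⁻¹ * (w j : ℝ) = ((Real.sqrt (2 : ℕ))⁻¹ • intVec w : E3) j := fun j => by
    rw [PiLp.smul_apply, intVec_apply, smul_eq_mul]
  simp_rw [hc, sum_sq_defect]
  exact pow_le_pow_left₀ (norm_nonneg _) (hθ _ hv) 2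

/-- **The six hcp second-shell constraints** on the defect matrix. [this file · kind: proof] -/
theorem defect_secondShell_hcp {Q : E3 →ₗᵢ[ℝ] E3} {A : E3 →ₗ[ℝ] E3} {θ : ℝ} (hθ : ∀ v ∈ hcpTwoShellPattern, ‖A v - Q v‖ ≤ θ) :
    ∀ w ∈ hcpSecondShellInt, ∑ i, (∑ j, defectMatrix Q A i j * ((Real.sqrt (18 : ℕ))⁻¹ * (w j : ℝ))) ^ 2 ≤ θ ^ 2 := by
  intro w hw
  have hv : ((Real.sqrt (18 : ℕ))⁻¹ • intVec w : E3) ∈ hcpTwoShellPattern := by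
    simp only [hcpTwoShellPattern, scaledPattern, Finset.mem_image]
    exact ⟨w, Finset.mem_union_right _ hw, rfl⟩
  have hc : ∀ j, (Real.sqrt (18 : ℕ))⁻¹ * (w j : ℝ) = ((Real.sqrt (18 : ℕ))⁻¹ • intVec w : E3) j := fun j => by
    rw [PiLp.smul_apply, intVec_apply, smul_eq_mul]
  simp_rw [hc, sum_sq_defect]
  exact pow_le_pow_left₀ (norm_nonneg _) (hθ _ hv) 2

/-- ★ **Frobenius bound of the layer-frame defect FROM THE CHART DATA** (either pattern): `Σ (Fᵀ·(Q⁻¹A − 1)·F)_ij² ≤ 3/2·θ²`.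
The hypotheses `hP`, `hθ` are the first two clauses of `AffFramed ε θ g y i`'s witness. [this file · kind: proof] -/
theorem sum_sq_layerFrame_chart_le {Q : E3 →ₗᵢ[ℝ] E3} {A : E3 →ₗ[ℝ] E3} {P : Finset E3} {θ : ℝ}
    (hP : P = fccTwoShellPattern ∨ P = hcpTwoShellPattern) (hθ : ∀ v ∈ P, ‖A v - Q v‖ ≤ θ)
    (F : Matrix (Fin 3) (Fin 3) ℝ) (hF : Fᵀ * F = 1) :
    ∑ i, ∑ j, (Fᵀ * defectMatrix Q A * F) i j ^ 2 ≤ 3 / 2 * θ ^ 2 := by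
  rcases hP with rfl | rfl
  · exact sum_sq_layerFrame_le_fcc _ F hF (defect_secondShell_fcc hθ)
  · exact sum_sq_layerFrame_le_hcp _ F hF (defect_secondShell_hcp hθ)

/-- ★ **THE BILAYER BOUND FROM THE CHART DATA, profile form** (`θ₀ = 10⁻³`): no matrix hypothesis left. [this file · kind: proof] -/
theorem bilayerExchange_chart_le_milli {a : ℝ} (ha : 0 < a) {Q : E3 →ₗᵢ[ℝ] E3} {A : E3 →ₗ[ℝ] E3} {P : Finset E3}
    (hP : P = fccTwoShellPattern ∨ P = hcpTwoShellPattern) (hθ : ∀ v ∈ P, ‖A v - Q v‖ ≤ 1 / 1000)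
    (F : Matrix (Fin 3) (Fin 3) ℝ) (hF : Fᵀ * F = 1) :
    |bilayerExchange a (Fᵀ * defectMatrix Q A * F)|
      ≤ 3 / 4 * (1 / 1000) ^ 2 * |kappaLJ a| + 544 / 10 ^ 9 * (a⁻¹) ^ 12 + 246 / 10 ^ 9 * (a⁻¹) ^ 6 :=
  (bilayer_exchange_le_milli ha _ ((sum_sq_layerFrame_chart_le hP hθ F hF).trans_eq (by ring))).2

/-- ★ **THE BILAYER BOUND FROM THE CHART DATA on the movers' window** `a ≥ 106/125`: `≤ 3/10⁵ + 46/10⁷`. [this file · kind: proof] -/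
theorem bilayerExchange_chart_le_window {a : ℝ} (ha : 106 / 125 ≤ a) {Q : E3 →ₗᵢ[ℝ] E3} {A : E3 →ₗ[ℝ] E3} {P : Finset E3}
    (hP : P = fccTwoShellPattern ∨ P = hcpTwoShellPattern) (hθ : ∀ v ∈ P, ‖A v - Q v‖ ≤ 1 / 1000)
    (F : Matrix (Fin 3) (Fin 3) ℝ) (hF : Fᵀ * F = 1) :
    |bilayerExchange a (Fᵀ * defectMatrix Q A * F)| ≤ 3 / 100000 + 46 / 10 ^ 7 :=
  bilayer_exchange_le_window ha _ ((sum_sq_layerFrame_chart_le hP hθ F hF).trans_eq (by ring))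

/-- ★ **THE CHIRALITY LINE PER TRIPLE COLUMN FROM THE CHART DATA**: each exchanged bilayer `i` read in its own `AffFramed` chart `(Q i, A i, P i)`
(either pattern) with layer frame `F i` at own scale `a i ≥ 106/125`: `≤ 3·(3/10⁵ + 46/10⁷)`. [this file · kind: proof] -/
theorem column_chirality_chart_le_window {s : ℤ → ℤ} (hs : IsHaggSeq s) (j : ℤ) (I : Finset ℤ) (a : ℤ → ℝ)
    (Q : ℤ → (E3 →ₗᵢ[ℝ] E3)) (A : ℤ → (E3 →ₗ[ℝ] E3)) (P : ℤ → Finset E3) (F : ℤ → Matrix (Fin 3) (Fin 3) ℝ)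
    (ha : ∀ i ∈ I, 106 / 125 ≤ a i) (hP : ∀ i ∈ I, P i = fccTwoShellPattern ∨ P i = hcpTwoShellPattern)
    (hθ : ∀ i ∈ I, ∀ v ∈ P i, ‖A i v - Q i v‖ ≤ 1 / 1000) (hF : ∀ i ∈ I, (F i)ᵀ * F i = 1) :
    |∑ i ∈ I, (if tripleFlip j s i ≠ s i then bilayerExchange (a i) ((F i)ᵀ * defectMatrix (Q i) (A i) * F i) else 0)|
      ≤ 3 * (3 / 100000 + 46 / 10 ^ 7) :=
  column_chirality_le_window hs j I a (fun i => (F i)ᵀ * defectMatrix (Q i) (A i) * F i) ha fun i hi =>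
    (sum_sq_layerFrame_chart_le (hP i hi) (hθ i hi) (F i) (hF i hi)).trans_eq (by ring)

end Summit.AtomisticToContinuum.Crystallization.Theorems.OverbindingBudgetAffineRunCutChiralityFrame

end
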